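/-
Copyright (c) 2026. All rights reserved.
Released under Apache 2.0 license as described in the file LICENSE.
Authors: abc-iut cell, wave-6 cone prover seat abc-iut-w6-d025 (gen 4; successor N2 of the Prop 5.8 (vii) clause map), over
abc-iut-L4-t3's §5 interface (`LogFrobeniusCompatibility.lean`, `LogFrobeniusMonoAnalyticization.lean`,
`LogFrobeniusIotaAnMono.lean`), abc-iut-w4-d095's `nonarchGenuineMonoAnPf` and this seat's `archGenuineMonoAnChart` /
`LogFrobeniusArchGenuineIotaAnMono`.
-/
import Literature.AnabelianGeometry.AbsoluteAnabelian.LogFrobeniusMonoGenuineProp58viiPf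
import Literature.AnabelianGeometry.AbsoluteAnabelian.LogFrobeniusArchGenuineIotaAnMono
import HarnessLib

/-!
# [AbsTopIII] Def 5.4 / 5.6 / Prop 5.8 (vii): the PRODUCT of two log-Frobenius settings over the same `V(F_mod)`, and the
# two-sided setting with GENUINE nonarchimedean AND archimedean rows in ONE term

S. Mochizuki, *Topics in absolute anabelian geometry III*, J. Math. Sci. Univ. Tokyo 22 (2015) [MochizukiAbsTopIII2015];
manuscript `paper:url-5493eb38cbb7`: Def 5.4 (i)–(vii) pp. 125–128 (the global objects `Th•_T[Z]`, `Th•[Z]` have a component at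
EVERY `v ∈ V(F_mod)`, archimedean and nonarchimedean), Def 5.6 (ii)–(iv) pp. 135–136, Prop 5.8 (vii) p. 141 l. 37 – p. 142 l. 9
("`w ∈ W_non` (respectively, `w ∈ W_arc`)"; and Prop 5.8 (vii)/Cor 5.10: `An⊢[𝒩⊢⊞] := ∏_v An⊢[𝒩⊢⊞_v]`, fibred product over `Th⊢[Z]`).

## Why and what

The tree's GENUINE §5 settings are one-place-type models: abc-iut-w4-d095's `nonarchGenuineMonoAnPf p` (`𝒳 := 𝒞^{MLF}` at a
prime `p`; every archimedean place reads a stand-in) and this seat's `archGenuineMonoAnChart 𝔄` (`𝒳 := 𝒞^hol_TF` over an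
Aut-holomorphic field functor; every nonarchimedean place reads a stand-in) — honest limit N2 of the Prop 5.8 (vii) clause map.
Print's objects are GLOBAL: a theater has a component at every place.  This file builds

* `LogFrobeniusSetting.prod L₁ L₂` — the COMPONENTWISE PRODUCT of two settings over the same `(V(F_mod), isArc)`: every
  category is the product category, every functor / natural transformation / equivalence the product (Mathlib `Functor.prod`,
  `NatTrans.prod`, `NatIso.prod`, `Equivalence.prod`); the twist `Λ_ν` commutes with products (`frobeniusTwist_prod`).  Generic
  lemmas: `prod_ψOver` (ψ over `ℰ⊢` on the nose is inherited), `prodMonoAnalyticizationHomotopies`, `prod_cor510MonoCores`,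
  `prodIotaAnMono` (abc-iut-L4-t3's `ι^{An⊢⊞}` add-on is inherited);
* `LogFrobeniusSetting.genuineTwoSided p 𝔄 Vmod isArc := (nonarchGenuineMonoAnPf p Vmod isArc).prod (archGenuineMonoAnChart 𝔄
  Vmod isArc)` — ONE setting in which at a nonarchimedean `v` the first slot of `λ⊞_{v,ν}`, `ι⊞_{v,ε}`, `ψ^{An⊢⊞}_{v,ν}`,
  `ι^{An⊢⊞}_{v,ε}` is the GENUINE MLF / mono-analytic MLF datum and at an archimedean `v` the second slot is the GENUINE
  Aut-holomorphic / `TM⊢`–`TB⊞` datum; `𝒳 = 𝒞^{MLF} × 𝒞^hol_TF`, `ℰ⊢ = TG⊢-base × TM⊢`, `An⊢[𝒩⊢⊞] = An⊢_non × An⊢_arc` (print's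
  product over the two place TYPES), `κ` the product of the two on-the-nose equivalences; theorems `genuineTwoSided_ψOver`,
  `_cor510MonoCores`, `_iotaAnMono`, `exists_genuineTwoSided`.

HONEST LIMITS (named): (P1) `𝒳 = 𝒞^{MLF}_p × 𝒞^hol_TF` is a TWO-FACTOR PROXY of the global `Th•_T[Z]` (one nonarchimedean prime,
one archimedean field functor), not a category of global theaters (campaign L); (P2) at each place the OTHER factor's slot is
that model's stand-in (carried along, never read as print's datum): `𝒩⊞_v = 𝒩⊞_v^{non} × 𝒩⊞_v^{arc}` has a filler slot; (P3) the
limits of the factors persist (pf carriers = torsion-quotient model; `TB⊞`-component of `𝒩_v → 𝒩⊢_v` constant at archimedean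
`v`; `ℰ• = 𝒳` placeholder on the nonarchimedean factor; `Orb(−)` = identity; charts chosen inside definitions with
functoriality proved).  MODEL-LEVEL; refereed pre-IUT material; nothing here bears on [IUTchIII] Cor. 3.12; no side taken;
typed ≠ proved elsewhere.
-/

set_option autoImplicit false

noncomputable section

open CategoryTheory

universe u

namespace Literature.AnabelianGeometry.AbsoluteAnabelian

namespace LogFrobeniusSetting

variable {Vmod : Type u} {isArc : Vmod → Bool} (L₁ L₂ : LogFrobeniusSetting Vmod isArc)

/-! ## §1. The product of two settings -/

/-- The Frobenius twist of a product is the product of the twists. [cite: MochizukiAbsTopIII2015, Def 5.4 (vii) p. 128] -/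
theorem frobeniusTwist_prod (c : Bool) :
    frobeniusTwist (L₁.log.prod L₂.log) c = (frobeniusTwist L₁.log c).prod (frobeniusTwist L₂.log c) := by
  cases c <;> rfl

/-- The twisted source of `ι⊞` in the product is the product of the twisted sources. [cite: MochizukiAbsTopIII2015, Def 5.4 (vii) p. 128] -/
theorem frobeniusTwist_prod_comp (c : Bool) (v : Vmod) (ν : LogVertex (isArc v)) :
    frobeniusTwist (L₁.log.prod L₂.log) c ⋙ (L₁.lam v ν).prod (L₂.lam v ν) =
      (frobeniusTwist L₁.log c ⋙ L₁.lam v ν).prod (frobeniusTwist L₂.log c ⋙ L₂.lam v ν) := by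
  cases c <;> rfl

/-- **The componentwise PRODUCT of two log-Frobenius settings over the same `(V(F_mod), isArc)`** (module docstring): every
category the product category, every functor / transformation / equivalence the product.
[cite: MochizukiAbsTopIII2015, Def 5.4 (ii) p. 125] -/
def prod : LogFrobeniusSetting Vmod isArc where
  X := L₁.X × L₂.X
  E := L₁.E × L₂.E
  proj := L₁.proj.prod L₂.proj
  log := L₁.log.prod L₂.log
  logIsoId := NatIso.prod L₁.logIsoId L₂.logIsoId
  logOver := NatIso.prod L₁.logOver L₂.logOver
  Nplus v := L₁.Nplus v × L₂.Nplus v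
  N v := L₁.N v × L₂.N v
  forget v := (L₁.forget v).prod (L₂.forget v)
  toE v := (L₁.toE v).prod (L₂.toE v)
  lam v ν := (L₁.lam v ν).prod (L₂.lam v ν)
  lamOver v ν := NatIso.prod (L₁.lamOver v ν) (L₂.lamOver v ν)
  lam_spaceLink_eq_postLog v := by rw [L₁.lam_spaceLink_eq_postLog v, L₂.lam_spaceLink_eq_postLog v]
  iota v _ _ ε := eqToHom (frobeniusTwist_prod_comp L₁ L₂ _ v _) ≫ NatTrans.prod (L₁.iota v ε) (L₂.iota v ε)
  An := L₁.An × L₂.An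
  κAn := L₁.κAn.prod L₂.κAn
  φAn := L₁.φAn.prod L₂.φAn
  φAn_isEquivalence :=
    haveI := L₁.φAn_isEquivalence
    haveI := L₂.φAn_isEquivalence
    (L₁.φAn.asEquivalence.prod L₂.φAn.asEquivalence).isEquivalence_functor
  ηAn := NatIso.prod L₁.ηAn L₂.ηAn
  κAn₂ := L₁.κAn₂.prod L₂.κAn₂
  Emono := L₁.Emono × L₂.Emono
  monoAn := L₁.monoAn.prod L₂.monoAn
  NmonoPlus w := L₁.NmonoPlus w × L₂.NmonoPlus w
  Nmono w := L₁.Nmono w × L₂.Nmono w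
  forgetMono w := (L₁.forgetMono w).prod (L₂.forgetMono w)
  toEmono w := (L₁.toEmono w).prod (L₂.toEmono w)
  monoNplus v := (L₁.monoNplus v).prod (L₂.monoNplus v)
  monoN v := (L₁.monoN v).prod (L₂.monoN v)
  monoHomotopy v := NatIso.prod (L₁.monoHomotopy v) (L₂.monoHomotopy v)
  AnMono := L₁.AnMono × L₂.AnMono
  κAnMono := L₁.κAnMono.prod L₂.κAnMono
  ψAnMono w ν := (L₁.ψAnMono w ν).prod (L₂.ψAnMono w ν)

/-- `𝒳` of the product is the product of the `𝒳`'s. [cite: MochizukiAbsTopIII2015, Def 5.4 (ii) p. 125] -/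
theorem prod_X : (L₁.prod L₂).X = (L₁.X × L₂.X) := rfl

/-- `λ⊞_{v,ν}` of the product is the product. [cite: MochizukiAbsTopIII2015, Def 5.4 (iv) p. 127] -/
theorem prod_lam (v : Vmod) (ν : LogVertex (isArc v)) : (L₁.prod L₂).lam v ν = (L₁.lam v ν).prod (L₂.lam v ν) := rfl

/-- `ψ^{An⊢⊞}_{w,ν}` of the product is the product. [cite: MochizukiAbsTopIII2015, Prop 5.8 (vii) p. 141] -/
theorem prod_ψAnMono (w : Vmod) (ν : {ν : LogVertex (isArc w) // ν.IsCross}) :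
    (L₁.prod L₂).ψAnMono w ν = (L₁.ψAnMono w ν).prod (L₂.ψAnMono w ν) := rfl

/-- The mono-analyticization `ℰ• → ℰ⊢` of the product is the product. [cite: MochizukiAbsTopIII2015, Def 5.6 (ii) p. 135] -/
theorem prod_monoAn : (L₁.prod L₂).monoAn = L₁.monoAn.prod L₂.monoAn := rfl

variable {L₁ L₂}

/-- **`ψ` over `ℰ⊢` ON THE NOSE is inherited by the product.** [cite: MochizukiAbsTopIII2015, Definition 5.6 (iv) p. 136] -/
theorem prod_ψOver
    (h₁ : ∀ (w : Vmod) (ν : {ν : LogVertex (isArc w) // ν.IsCross}),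
      L₁.ψAnMono w ν ⋙ L₁.forgetMono w ⋙ L₁.toEmono w = L₁.κAnMono.inverse)
    (h₂ : ∀ (w : Vmod) (ν : {ν : LogVertex (isArc w) // ν.IsCross}),
      L₂.ψAnMono w ν ⋙ L₂.forgetMono w ⋙ L₂.toEmono w = L₂.κAnMono.inverse)
    (w : Vmod) (ν : {ν : LogVertex (isArc w) // ν.IsCross}) :
    (L₁.prod L₂).ψAnMono w ν ⋙ (L₁.prod L₂).forgetMono w ⋙ (L₁.prod L₂).toEmono w = (L₁.prod L₂).κAnMono.inverse := by
  change (L₁.ψAnMono w ν ⋙ L₁.forgetMono w ⋙ L₁.toEmono w).prod (L₂.ψAnMono w ν ⋙ L₂.forgetMono w ⋙ L₂.toEmono w) =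
    L₁.κAnMono.inverse.prod L₂.κAnMono.inverse
  rw [h₁, h₂]

/-- abc-iut-L4-t3's `MonoAnalyticizationHomotopies` of the product from those of the factors (componentwise).
[cite: MochizukiAbsTopIII2015, Cor 5.10 p. 146] -/
def prodMonoAnalyticizationHomotopies (M₁ : L₁.MonoAnalyticizationHomotopies) (M₂ : L₂.MonoAnalyticizationHomotopies) :
    (L₁.prod L₂).MonoAnalyticizationHomotopies where
  toE v := NatIso.prod (M₁.toE v) (M₂.toE v)
  anToE := NatIso.prod M₁.anToE M₂.anToE

/-- **Cor 5.10 (iv)(a) for the product** (`V(F_mod) ≠ ∅`), from the factors' mono-analyticization homotopies.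
[cite: MochizukiAbsTopIII2015, Cor 5.10 (iv)(a) p. 147] -/
theorem prod_cor510MonoCores [Nonempty Vmod] (M₁ : L₁.MonoAnalyticizationHomotopies)
    (M₂ : L₂.MonoAnalyticizationHomotopies) : (L₁.prod L₂).Cor510MonoCores :=
  cor510MonoCores_holds (prodMonoAnalyticizationHomotopies M₁ M₂)

/-- The product `hψ`: if `ψ` of each factor lies over `ℰ⊢` up to given isomorphisms, so does `ψ` of the product
(componentwise). [cite: MochizukiAbsTopIII2015, Definition 5.6 (iv) p. 136] -/
def prodψOverIso
    (hψ₁ : ∀ (w : Vmod) (j : {ν : LogVertex (isArc w) // ν.IsCross}),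
      L₁.ψAnMono w j ⋙ L₁.forgetMono w ⋙ L₁.toEmono w ≅ L₁.κAnMono.inverse)
    (hψ₂ : ∀ (w : Vmod) (j : {ν : LogVertex (isArc w) // ν.IsCross}),
      L₂.ψAnMono w j ⋙ L₂.forgetMono w ⋙ L₂.toEmono w ≅ L₂.κAnMono.inverse)
    (w : Vmod) (j : {ν : LogVertex (isArc w) // ν.IsCross}) :
    (L₁.prod L₂).ψAnMono w j ⋙ (L₁.prod L₂).forgetMono w ⋙ (L₁.prod L₂).toEmono w ≅ (L₁.prod L₂).κAnMono.inverse :=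
  NatIso.prod (hψ₁ w j) (hψ₂ w j)

/-- **abc-iut-L4-t3's add-on `ι^{An⊢⊞}` is inherited by the product** (componentwise `ι`; "over `Th⊢[Z]`" componentwise).
[cite: MochizukiAbsTopIII2015, Prop 5.8 (vii) p. 142] -/
def prodIotaAnMono
    {hψ₁ : ∀ (w : Vmod) (j : {ν : LogVertex (isArc w) // ν.IsCross}),
      L₁.ψAnMono w j ⋙ L₁.forgetMono w ⋙ L₁.toEmono w ≅ L₁.κAnMono.inverse}
    {hψ₂ : ∀ (w : Vmod) (j : {ν : LogVertex (isArc w) // ν.IsCross}),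
      L₂.ψAnMono w j ⋙ L₂.forgetMono w ⋙ L₂.toEmono w ≅ L₂.κAnMono.inverse}
    (I₁ : L₁.IotaAnMono hψ₁) (I₂ : L₂.IotaAnMono hψ₂) : (L₁.prod L₂).IotaAnMono (prodψOverIso hψ₁ hψ₂) where
  ι w _ _ ε hε := NatTrans.prod (I₁.ι w ε hε) (I₂.ι w ε hε)
  ι_over w _ _ ε hε X := Prod.ext (I₁.ι_over w ε hε X.1) (I₂.ι_over w ε hε X.2)

end LogFrobeniusSetting

/-! ## §2. The two-sided genuine setting -/

namespace LogFrobeniusSetting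

variable (p : ℕ) [Fact p.Prime] (𝔄 : AutHolFieldFunctor.{0}) (Vmod : Type 1) (isArc : Vmod → Bool)

/-- **ONE §5 setting with GENUINE rows at BOTH kinds of place** (module docstring): the product of abc-iut-w4-d095's genuine
nonarchimedean mono-analytic model at the prime `p` and this seat's genuine archimedean model over `𝔄` with the genuine
mono-analyticization `EA → TM⊢`. [cite: MochizukiAbsTopIII2015, Prop 5.8 (vii) p. 141] -/
def genuineTwoSided : LogFrobeniusSetting Vmod isArc :=
  (nonarchGenuineMonoAnPf p Vmod isArc).prod (archGenuineMonoAnChart 𝔄 Vmod isArc)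

/-- `𝒳 = 𝒞^{MLF}_p × 𝒞^hol_TF` (two-factor proxy of the global `Th•_T[Z]`, honest limit (P1)).
[cite: MochizukiAbsTopIII2015, Def 5.4 (i) p. 125] -/
theorem genuineTwoSided_X : (genuineTwoSided p 𝔄 Vmod isArc).X = (Up (AbsTopIII.TFModel p) × Up (HolTFPair 𝔄)) := rfl

/-- `ℰ⊢ = TG⊢-base × TM⊢` and `An⊢[𝒩⊢⊞] = An⊢_non × An⊢_arc` (print's product over the two place types).
[cite: MochizukiAbsTopIII2015, Prop 5.8 (vii) p. 141] -/
theorem genuineTwoSided_Emono_AnMono :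
    (genuineTwoSided p 𝔄 Vmod isArc).Emono = (Up MLFClosure.MonoBase × TMMono.{1}) ∧
      (genuineTwoSided p 𝔄 Vmod isArc).AnMono = (Up MLFClosure.AnMono × TMMono.AnArc.{1}) := ⟨rfl, rfl⟩

/-- `λ⊞_{v,ν}`: the genuine MLF slot and the genuine archimedean slot. [cite: MochizukiAbsTopIII2015, Def 5.4 (iv) p. 127] -/
theorem genuineTwoSided_lam (v : Vmod) (ν : LogVertex (isArc v)) :
    (genuineTwoSided p 𝔄 Vmod isArc).lam v ν = (nonarchLam p (isArc v) ν).prod (archLam 𝔄 (isArc v) ν) := rfl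

/-- `ψ^{An⊢⊞}_{w,ν}`: the genuine `ψMonoPf` slot (`w ∈ W_non`) and the genuine `ψArc` slot (`w ∈ W_arc`).
[cite: MochizukiAbsTopIII2015, Prop 5.8 (vii) p. 141] -/
theorem genuineTwoSided_ψAnMono (w : Vmod) (ν : {ν : LogVertex (isArc w) // ν.IsCross}) :
    (genuineTwoSided p 𝔄 Vmod isArc).ψAnMono w ν =
      (Up.liftF (MLFClosure.ψMonoPf (isArc w) ν.1)).prod (TMMono.ψArc (isArc w) ν.1) := rfl

/-- `ℰ• → ℰ⊢`: `(toMonoBase, toTMMono)` — genuine on both factors. [cite: MochizukiAbsTopIII2015, Def 5.6 (ii) p. 135] -/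
theorem genuineTwoSided_monoAn :
    (genuineTwoSided p 𝔄 Vmod isArc).monoAn =
      (Up.liftF (AbsTopIII.TFModel.toMonoBase p)).prod (inducedFunctor _ ⋙ 𝔄.toTMMono) := rfl

/-- **`ψ^{An⊢⊞}` lies over `ℰ⊢` ON THE NOSE** in the two-sided setting. [cite: MochizukiAbsTopIII2015, Definition 5.6 (iv) p. 136] -/
theorem genuineTwoSided_ψOver (w : Vmod) (ν : {ν : LogVertex (isArc w) // ν.IsCross}) :
    (genuineTwoSided p 𝔄 Vmod isArc).ψAnMono w ν ⋙ (genuineTwoSided p 𝔄 Vmod isArc).forgetMono w ⋙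
        (genuineTwoSided p 𝔄 Vmod isArc).toEmono w =
      (genuineTwoSided p 𝔄 Vmod isArc).κAnMono.inverse :=
  prod_ψOver (nonarchGenuineMonoAnPf_ψOver p Vmod isArc) (archGenuineMonoAnChart_ψOver 𝔄 Vmod isArc) w ν

/-- abc-iut-L4-t3's `MonoAnalyticizationHomotopies` inhabited in the two-sided setting. [cite: MochizukiAbsTopIII2015, Cor 5.10 p. 146] -/
def genuineTwoSided_monoAnalyticizationHomotopies : (genuineTwoSided p 𝔄 Vmod isArc).MonoAnalyticizationHomotopies :=
  prodMonoAnalyticizationHomotopies (nonarchGenuineMonoAnPf_monoAnalyticizationHomotopies p Vmod isArc)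
    (archGenuineMonoAnChart_monoAnalyticizationHomotopies 𝔄 Vmod isArc)

/-- **[AbsTopIII] Cor 5.10 (iv)(a) HOLDS in the two-sided setting** (`V(F_mod) ≠ ∅`).
[cite: MochizukiAbsTopIII2015, Cor 5.10 (iv)(a) p. 147] -/
theorem genuineTwoSided_cor510MonoCores [Nonempty Vmod] : (genuineTwoSided p 𝔄 Vmod isArc).Cor510MonoCores :=
  cor510MonoCores_holds (genuineTwoSided_monoAnalyticizationHomotopies p 𝔄 Vmod isArc)

/-- The `hψ` of the two-sided setting: the product of the two identity isomorphisms (`ψ` over `ℰ⊢` on the nose on both factors).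
[cite: MochizukiAbsTopIII2015, Definition 5.6 (iv) p. 136] -/
def genuineTwoSided_ψOverIso (w : Vmod) (j : {ν : LogVertex (isArc w) // ν.IsCross}) :
    (genuineTwoSided p 𝔄 Vmod isArc).ψAnMono w j ⋙ (genuineTwoSided p 𝔄 Vmod isArc).forgetMono w ⋙
        (genuineTwoSided p 𝔄 Vmod isArc).toEmono w ≅
      (genuineTwoSided p 𝔄 Vmod isArc).κAnMono.inverse :=
  prodψOverIso (nonarchGenuineMonoAnPf_ψOverIso p Vmod isArc) (archGenuineMonoAnChart_ψOverIso 𝔄 Vmod isArc) w j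

/-- ★ **abc-iut-L4-t3's add-on `IotaAnMono` INHABITED in the two-sided setting**: `ι^{An⊢⊞}_{w,ε}` for every edge of `Γ⃗×_w`,
BOTH kinds of `w` — abc-iut-f-101's genuine perfection arrows in the nonarchimedean slot (abc-iut-w4-d095's instance) and the
functorial covering `k∼ ↠ k×` in the archimedean slot (this seat's instance). [cite: MochizukiAbsTopIII2015, Prop 5.8 (vii) p. 142] -/
def genuineTwoSided_iotaAnMono :
    (genuineTwoSided p 𝔄 Vmod isArc).IotaAnMono (genuineTwoSided_ψOverIso p 𝔄 Vmod isArc) :=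
  prodIotaAnMono (nonarchGenuineMonoAnPf_iotaAnMono p Vmod isArc) (archGenuineMonoAnChart_iotaAnMono 𝔄 Vmod isArc)

/-- **Summary**: ONE §5 setting with `ℰ⊢ = TG⊢-base × TM⊢`, `An⊢[𝒩⊢⊞] = An⊢_non × An⊢_arc`, `ψ^{An⊢⊞}` genuine at every vertex
of `Γ⃗×_w` for BOTH kinds of `w` and over `ℰ⊢`, `ι^{An⊢⊞}` at every edge of `Γ⃗×_w` (add-on inhabited), and Cor 5.10 (iv)(a) for
`V(F_mod) ≠ ∅`. [cite: MochizukiAbsTopIII2015, Prop 5.8 (vii) p. 141] -/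
theorem exists_genuineTwoSided :
    ∃ (L : LogFrobeniusSetting Vmod isArc)
      (hψ : ∀ (w : Vmod) (j : {ν : LogVertex (isArc w) // ν.IsCross}),
        L.ψAnMono w j ⋙ L.forgetMono w ⋙ L.toEmono w ≅ L.κAnMono.inverse),
      L.X = (Up (AbsTopIII.TFModel p) × Up (HolTFPair 𝔄)) ∧ L.Emono = (Up MLFClosure.MonoBase × TMMono.{1}) ∧
      L.AnMono = (Up MLFClosure.AnMono × TMMono.AnArc.{1}) ∧
      (∀ w ν, L.ψAnMono w ν ⋙ L.forgetMono w ⋙ L.toEmono w = L.κAnMono.inverse) ∧ Nonempty (L.IotaAnMono hψ) ∧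
      (Nonempty Vmod → L.Cor510MonoCores) :=
  ⟨genuineTwoSided p 𝔄 Vmod isArc, genuineTwoSided_ψOverIso p 𝔄 Vmod isArc, rfl, rfl, rfl,
    genuineTwoSided_ψOver p 𝔄 Vmod isArc, ⟨genuineTwoSided_iotaAnMono p 𝔄 Vmod isArc⟩,
    fun h => haveI := h; genuineTwoSided_cor510MonoCores p 𝔄 Vmod isArc⟩

end LogFrobeniusSetting

end Literature.AnabelianGeometry.AbsoluteAnabelian

end
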